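import Literature.Probability.Percolation.SlabRSWGluingLobeB
import Literature.Probability.Percolation.SlabRSWGluingNearOfCross
import Literature.Probability.Percolation.SlabRSWGluingHighProbTop
import HarnessLib

/-!
# Newman–Tassion–Wu 2017, §3.4: crossing an L-shaped region — the two-domain planar crossing for the
# lobe geometry and the `Γ`-free gluing lemma in both regimes

Topic: `Literature/Probability/Percolation`. In the L-shaped domain `R = S ∪ V` of `LobeSetup` (`S` the
horizontal rectangle, `V` the lobe under its left end), an open path from the bottom of the lobe to the
top row of `S` enters `S` through the top of the lobe and then crosses `S` from its bottom row to its top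
row, so it meets every left-right crossing `Γ` of `S` (planar projections). With `glue_highProb_lobe` /
`glue_linear_lobe` this gives the gluing used for (3.65)–(3.70) of the proof of Theorem 3.10: the event
"bottom of the lobe `⟷^R` top of `S`" (essentially the top-bottom crossing of the vertical arm) and the
left-right crossing of `S` glue to "bottom of the lobe `⟷^R` right side of `S`" = the crossing of the L.

* `cross₂_of_lobe`, **`glue0_highProb_lobe`** (`ε-δ`), **`glue0_linear_lobe`** (product form).

## Sources

* C. M. Newman, V. Tassion, W. Wu, *Critical percolation and the minimal spanning tree in slabs*,
  Comm. Pure Appl. Math. 70 (2017), arXiv:1512.09107: §3.4, proof of Theorem 3.10 ((3.65): "several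
  gluing procedures similar to those used in the proof of Proposition 3.9"), Theorem 3.6/3.7 with
  Remarks 2–3 [NewmanTassionWu2017].
-/

noncomputable section

namespace Literature.Probability.Percolation

open MeasureTheory LatticeModels SimpleGraph

namespace NTW17

variable {k : ℕ}

/-- **The two-domain planar crossing for the lobe geometry**: in `R = S ∪ V`, `S = [a,b]×[c,d]`,
`V = [a,a']×[c',c-1]`, every planar walk in `S` from the column `x = b` to the column `x = a` meets every
planar walk in `R` from the rows `≤ c - 1` (the lobe) to the row `y = d` (the latter's portion after its
last visit to the lobe rows is a bottom-top crossing of `S`).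
[cite: NewmanTassionWu2017, §3.4 (proof of Theorem 3.10, (3.65))] -/
theorem cross₂_of_lobe (G : LobeSetup) {A B C Dd : Set (ℤ × ℤ)}
    (hA : ∀ z ∈ A, z.1 = G.b) (hB : ∀ z ∈ B, z.1 = G.a) (hC : ∀ z ∈ C, z.2 ≤ G.c - 1)
    (hD : ∀ z ∈ Dd, z.2 = G.d) :
    ∀ (l₁ l₂ : List (ℤ × ℤ)) (h₁ : l₁ ≠ []) (h₂ : l₂ ≠ []), IsPlanarWalk l₁ → IsPlanarWalk l₂ →
      (∀ z ∈ l₁, z ∈ G.S) → (∀ z ∈ l₂, z ∈ G.R) → l₁.head h₁ ∈ A → l₁.getLast h₁ ∈ B →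
      l₂.head h₂ ∈ C → l₂.getLast h₂ ∈ Dd → ∃ z ∈ l₁, z ∈ l₂ := by
  intro l₁ l₂ h₁ h₂ hw₁ hw₂ hS₁ hS₂ hhA hlB hhC hlD
  have hcd := G.hcd
  -- the last vertex `x` of `l₂` in the lobe rows
  have hrev : ∃ x ∈ l₂.reverse, x.2 ≤ G.c - 1 :=
    ⟨l₂.head h₂, by simp [List.head_mem h₂], hC _ hhC⟩
  obtain ⟨m₁, x, m₂, hmeq, hxb, hm₁⟩ := exists_first_split (p := fun z : ℤ × ℤ => z.2 ≤ G.c - 1) l₂.reverse hrev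
  have hl₂eq : l₂ = m₂.reverse ++ x :: m₁.reverse := by
    have := congrArg List.reverse hmeq
    simpa using this
  -- `m₁ ≠ []` (the last vertex of `l₂` is on the row `d`) and the first vertex `y` after `x` is on the row `c`
  have hm₁ne : m₁ ≠ [] := by
    intro hm
    subst hm
    have hlast : l₂.getLast h₂ = x := by
      rw [List.getLast_congr _ (by simp) hl₂eq]; simp
    have h1 := hD _ hlD
    rw [hlast] at h1
    omega
  obtain ⟨y, ys, hys⟩ := List.exists_cons_of_ne_nil (show m₁.reverse ≠ [] by simpa using hm₁ne)
  rw [hys] at hl₂eq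
  have hsufsub : ∀ z ∈ y :: ys, z ∈ l₂ := by
    intro z hz; rw [hl₂eq]; exact List.mem_append_right _ (List.mem_cons_of_mem _ hz)
  have hsufrows : ∀ z ∈ y :: ys, ¬z.2 ≤ G.c - 1 := by
    intro z hz
    exact hm₁ z (by rw [← List.mem_reverse, hys]; exact hz)
  have hwxs : IsPlanarWalk (x :: y :: ys) := by
    have hw : IsPlanarWalk (m₂.reverse ++ x :: y :: ys) := by rw [← hl₂eq]; exact hw₂
    exact (List.isChain_append.1 hw).2.1
  have hwsuf : IsPlanarWalk (y :: ys) := (List.isChain_cons_cons.1 hwxs).2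
  have hyrow : y.2 = G.c := by
    have hy : ¬y.2 ≤ G.c - 1 := hsufrows y (by simp)
    have hstep : x = y ∨ planarAdj x y := (List.isChain_cons_cons.1 hwxs).1
    rcases hstep with rfl | h
    · exact absurd hxb hy
    · obtain ⟨x1, x2⟩ := x; obtain ⟨y1, y2⟩ := y
      simp only [planarAdj, Prod.mk_add_mk, Prod.mk.injEq, add_zero] at h
      simp only at hxb hy ⊢
      omega
  have hsufS : ∀ z ∈ y :: ys, z ∈ G.S := by
    intro z hz
    have hzR := hS₂ z (hsufsub z hz)
    rcases LobeSetup.mem_R_iff.1 hzR with h | h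
    · exact h
    · exact absurd (LobeSetup.mem_V_iff.1 h).2.2.2 (hsufrows z hz)
  have hne : (y :: ys) ≠ [] := List.cons_ne_nil _ _
  have hhead' : ((y :: ys).head hne).2 = G.c := by simpa using hyrow
  have hlast' : ((y :: ys).getLast hne).2 = G.d := by
    have e1 : l₂.getLast h₂ = (x :: y :: ys).getLast (by simp) := by
      rw [List.getLast_congr _ (by simp) hl₂eq, List.getLast_append_of_ne_nil _ (by simp)]
    have e2 : (x :: y :: ys).getLast (by simp) = (y :: ys).getLast hne := by simp
    rw [← e2, ← e1]; exact hD _ hlD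
  -- reverse `l₁`: a walk in `S` from the column `a` to the column `b`
  have hw₁' : IsPlanarWalk l₁.reverse := by
    rw [IsPlanarWalk, List.isChain_reverse]
    refine hw₁.imp fun p q h => ?_
    rcases h with h | h
    · exact Or.inl h.symm
    · exact Or.inr (planarAdj_symm h)
  have h₁' : l₁.reverse ≠ [] := by simpa using h₁
  obtain ⟨z, hz₁, hz₂⟩ := planarCrossing_rect (a := G.a) (b := G.b) (c := G.c) (d := G.d)
    (A := B) (B := A) (C := {z | z.2 = G.c}) (D := {z | z.2 = G.d}) hB hA (fun z hz => hz) (fun z hz => hz)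
    l₁.reverse (y :: ys) h₁' hne hw₁' hwsuf (fun z hz => hS₁ z (List.mem_reverse.1 hz)) hsufS
    (by rw [List.head_reverse]; exact hlB) (by rw [List.getLast_reverse]; exact hhA) hhead' hlast'
  exact ⟨z, List.mem_reverse.1 hz₁, hsufsub z hz₂⟩

/-- **GL in the L-shaped domain, high-probability regime, `Γ`-free form**: for every `k ≥ 1`, `ρ ≥ 2`,
`ε > 0`, `η > 0` there is `δ > 0` such that for every `LobeSetup` `G` (side conditions of
`glue_highProb_lobe`) with `A` on the right side of `S`, `C` in the lobe rows and `D′` on the top row of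
`S`, and every `p ∈ [ε,1-ε]`: `P_p[A ⟷^S B] ≥ 1-δ` and `P_p[C ⟷^R D′] ≥ 1-δ` imply `P_p[C ⟷^R A] ≥ 1-η`.
[cite: NewmanTassionWu2017, Theorem 3.6/3.7 (high-probability regime) in the geometry of §3.4 (proof of Theorem 3.10)] -/
theorem glue0_highProb_lobe (k ρ : ℕ) (hk : 1 ≤ k) (hρ : 2 ≤ ρ) {ε : ℝ} (hε : 0 < ε) {η : ℝ} (hη : 0 < η) :
    ∃ δ : ℝ, 0 < δ ∧ ∀ (G : LobeSetup) (Dd : Set (ℤ × ℤ)), G.a + 2 * ρ + 6 ≤ G.a' →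
      (∀ a'' ∈ G.A, G.a' + 2 * ρ + 8 ≤ a''.1) →
      (∀ a' ∈ G.A, ∀ c' ∈ G.C, c' ∉ sqBox a' (4 * ρ + 8)) →
      (∀ c' ∈ G.C, ∀ s' ∈ G.S, c' ∉ sqBox s' (2 * ρ + 3)) →
      (∀ z ∈ G.A, z.1 = G.b) → (∀ z ∈ G.C, z.2 ≤ G.c - 1) → (∀ z ∈ Dd, z.2 = G.d) →
      ∀ (p : unitInterval), ε ≤ (p : ℝ) → (p : ℝ) ≤ 1 - ε →
      1 - δ ≤ (bondPercolation (slabGraph 3 k) p).real (G.Q.evAB k) →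
      1 - δ ≤ (bondPercolation (slabGraph 3 k) p).real (slabConn k G.R G.C Dd) →
      1 - η ≤ (bondPercolation (slabGraph 3 k) p).real (G.Q.evCA k) := by
  obtain ⟨δ, hδ, H⟩ := glue_highProb_lobe k ρ hk hρ hε hη
  refine ⟨δ / 2, by linarith, fun G Dd hwide hAfar hsep hfarC hA hC hD p hpε hp1 hAB hCD => ?_⟩
  refine H G hwide hAfar hsep hfarC p hpε hp1 ?_
  have hcross := cross₂_of_lobe G (A := G.Q.A) (B := G.Q.B) (C := G.Q.C) (Dd := Dd) hA
    (fun z hz => (LobeSetup.mem_B_iff.1 hz).2) hC hD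
  have h := GlueData.real_evNear_ge_of_cross₂ (Q := G.Q) (k := k) (ρ := ρ) (Dd := Dd) hcross p
  have : (bondPercolation (slabGraph 3 k) p).real (slabConn k G.Q.R G.Q.C Dd) =
      (bondPercolation (slabGraph 3 k) p).real (slabConn k G.R G.C Dd) := rfl
  linarith

/-- **GL in the L-shaped domain, linear regime, `Γ`-free product form**: under the side conditions of
`glue_linear_lobe`, with `A` on the right side of `S`, `C` in the lobe rows, `D′` on the top row of `S`,
for `0 < p < 1`: `P_p[A ⟷^S B] · P_p[C ⟷^R D′] ≤ (1 + λ_p^s) · P_p[C ⟷^R A]` (Harris–FKG for the two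
increasing events, then the contact). [cite: NewmanTassionWu2017, Theorem 3.6 with Remark 3, §3.4 ((3.65))] -/
theorem glue0_linear_lobe (G : LobeSetup) (hk : 1 ≤ k) {ρ : ℕ} (hρ : 2 ≤ ρ) (hwide : G.a + 2 * ρ + 6 ≤ G.a')
    (hAfar : ∀ a'' ∈ G.A, G.a' + 2 * ρ + 8 ≤ a''.1)
    (hsep : ∀ a' ∈ G.A, ∀ c' ∈ G.C, c' ∉ sqBox a' (4 * ρ + 8))
    (hfarC : ∀ c' ∈ G.C, ∀ s' ∈ G.S, c' ∉ sqBox s' (2 * ρ + 3))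
    {Dd : Set (ℤ × ℤ)} (hA : ∀ z ∈ G.A, z.1 = G.b) (hC : ∀ z ∈ G.C, z.2 ≤ G.c - 1) (hD : ∀ z ∈ Dd, z.2 = G.d)
    (p : unitInterval) (hp0 : 0 < (p : ℝ)) (hp1 : (p : ℝ) < 1) :
    (bondPercolation (slabGraph 3 k) p).real (slabConn k G.S G.A G.B) *
        (bondPercolation (slabGraph 3 k) p).real (slabConn k G.R G.C Dd) ≤
      (1 + (2 / min (p : ℝ) (1 - p)) ^ (3 * ((5 * k + 4) * (2 * (2 * (ρ + 3)) + 1) ^ 2))) *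
        (bondPercolation (slabGraph 3 k) p).real (slabConn k G.R G.C G.A) := by
  set P := bondPercolation (slabGraph 3 k) p with hP
  have hlocS : IsLocalEvent (slabConn k G.S G.A G.B) := by
    refine ⟨(finite_sym2 (slabLift_finite k (boxR_finite G.a G.b G.c G.d))).toFinset, ?_⟩
    rw [Set.Finite.coe_toFinset]
    exact determinedBy_slabConn k _ _ subset_rfl
  have hlocR : IsLocalEvent (slabConn k G.R G.C Dd) := by
    refine ⟨(finite_sym2 (slabLift_finite k G.R_finite)).toFinset, ?_⟩
    rw [Set.Finite.coe_toFinset]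
    exact determinedBy_slabConn k _ _ subset_rfl
  -- Harris–FKG
  have hH : P.real (slabConn k G.S G.A G.B) * P.real (slabConn k G.R G.C Dd) ≤
      P.real (slabConn k G.S G.A G.B ∩ slabConn k G.R G.C Dd) :=
    harris_fkg_local (slabGraph 3 k) p (isUpperSet_openCrossing _ _ _) (isUpperSet_openCrossing _ _ _)
      hlocS hlocR
  -- the intersection forces a contact, almost surely
  have hcross := cross₂_of_lobe G (A := G.Q.A) (B := G.Q.B) (C := G.Q.C) (Dd := Dd) hA
    (fun z hz => (LobeSetup.mem_B_iff.1 hz).2) hC hD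
  have hae : ∀ᵐ ω ∂P, ω ∈ slabConn k G.S G.A G.B ∩ slabConn k G.R G.C Dd →
      ω ∈ G.Q.evAB k ∩ G.Q.evNear k ρ := by
    filter_upwards [ae_subset_edgeSet (slabGraph 3 k) p] with ω hω
    rintro ⟨hAB, hCD⟩
    exact ⟨hAB, GlueData.mem_evNear_of_cross₂ (Q := G.Q) hcross hω hAB hCD⟩
  have hmono : P.real (slabConn k G.S G.A G.B ∩ slabConn k G.R G.C Dd) ≤
      P.real (G.Q.evAB k ∩ G.Q.evNear k ρ) := by
    simp only [measureReal_def]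
    exact ENNReal.toReal_mono (measure_ne_top _ _) (measure_mono_ae hae)
  exact hH.trans (hmono.trans (glue_linear_lobe G hk hρ hwide hAfar hsep hfarC p hp0 hp1))

end NTW17

end Literature.Probability.Percolation

end
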